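import Summits.RiemannHypothesis.RiemannHypothesis.Theorems.WeilFormatCDataRung
import Literature.NumberTheory.LFunctions.YoshidaWindowGramFrontDoorW
import Summits.RiemannHypothesis.RiemannHypothesis.Theorems.WeilFormatCDataKit
import HarnessLib

/-!
# Format C: the KERNEL front door, variant W — per-column weights in the odd sector

Helper file of the rh-explicit Weil-positivity programme (`--supports stmt-RiemannHypothesis-0098`; seat
rh-explicit-weil-2), RH-free, no definitions, no named facts.  It composes weil-10's data front door
`WeilFormatC.weilPositivityOn_of_formatC_data` (two kernel PSD facts + finitely many numeric inequalities ⟹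
`WeilPositivityOn a`) with weil-2's kernel evaluator (`Literature/…/YoshidaWindowGram{Enclosure, Records, EntryBox,
Columns, FrontDoor}.lean`): every remaining hypothesis is (i) a validity fact delivered by a `decide +kernel` data
certificate (`ConstsValid`, `FDValid`, `PrimeData`, `TabValid`, `TabColValid`), (ii) an entrywise enclosure `near` of
the per-sector Schur matrix (`Encl.even_front_near` / `Encl.odd_front_near`, possibly assembled from row bands),
(iii) a `PsdDyadic.checkPsdMid` verdict on those midpoints, or (iv) an INTEGER comparison of a box endpoint
(far-diagonal positivity, the weight `w = wz·2^{−cd}`, the tail base `d₀ = d0z·2^{−cd}`).  The column weights are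
CONSTANT in the even sector (`w ≤ d̂⁺(B) ≤ d̂⁺(m)` by `even_dhat_core_mono`) and PER-COLUMN in the odd sector
(`w_l ≤ d̂⁻_atan(l)` certified column by column by `Encl.checkWeightsOdd`, part VI) — the base rung's odd Schur
matrix is PSD only with the latter (measured at `B = 24`, `B₃ = 4000`).
-/

set_option linter.dupNamespace false
set_option autoImplicit false

noncomputable section

open Complex Finset Matrix
open scoped Real BigOperators ArithmeticFunction.vonMangoldt

namespace Summit.RiemannHypothesis.RiemannHypothesis.Theorems.WeilFormatC

open Literature.NumberTheory.LFunctions Literature.NumberTheory.LFunctions.Yoshida1992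
  Literature.NumberTheory.LFunctions.Yoshida1992.Encl Literature.Analysis.SpecialFunctions
  Literature.Analysis.ValidatedNumerics.NumericsMP

variable {a : ℝ} {S : ℕ} {ks : List PrimeLen} {C : Consts} {F : FDConsts}

/-- **`WeilPositivityOn a` from the data kit.**  All hypotheses are delivered by `decide +kernel` certificates of the
generated rung files (validity of constants / front-door constants / prime data / tables, the two `near` enclosures,
the two `PsdDyadic` verdicts) or are integer comparisons of box endpoints. -/
theorem weilPositivityOn_of_kitW (ha : 0 < a) (hS : 0 < S) (hC : ConstsValid S a ks C)
    (hF : FDValid S a F) {tab : List IdxRec}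
    -- EVEN sector
    {Be B3e : ℕ} (hBe : 2 ≤ Be) (hBBe : 2 * Be ≤ B3e) {ctabE : List IdxRec}
    (hTe : TabValid S a ks (Be + 1) tab) (hCTe : TabColValid S a ks Be (B3e + 1) ctabE)
    {ce cde wze d0ze pe qe : ℕ} (hwze : 0 < wze) (hd0ze : 0 < d0ze) (hsqe : checkSqrtUpper 8 (Be - 1) pe qe = true)
    (h0e : 0 < (devEvenBox S C F (tget tab Be) Be pe qe).lo)
    (hwe : (wze : ℤ) * (S : ℤ) ≤ (devEvenBox S C F (tget tab Be) Be pe qe).lo * 2 ^ cde)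
    (hd0e : (d0ze : ℤ) * (S : ℤ) ≤ (devEvenBox S C F (tget ctabE B3e) B3e pe qe).lo * 2 ^ cde)
    {ρe δe : ℤ} {DSe Le : List (List ℤ)} (hPe : PsdDyadic.checkPsdMid Be δe ρe DSe Le = true)
    (hneare : ∀ i j : Fin Be,
      |((if (i : ℕ) = 0 then gramCoeff a 0 j else if (j : ℕ) = 0 then gramCoeff a i 0
          else (gramCoeff a i j + gramCoeff a i (-(j : ℤ))) / 2)
        - (∑ m ∈ Finset.Ico Be B3e, (if (i : ℕ) = 0 then gramCoeff a 0 m else if m = 0 then gramCoeff a i 0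
            else (gramCoeff a i m + gramCoeff a i (-(m : ℤ))) / 2) *
            (if (j : ℕ) = 0 then gramCoeff a 0 m else if m = 0 then gramCoeff a j 0
            else (gramCoeff a j m + gramCoeff a j (-(m : ℤ))) / 2) / ((fun _ : ℕ ↦ (wze : ℝ) * (1 / 2 ^ cde)) m))
        - U2Even a 1 ((d0ze : ℝ) * (1 / 2 ^ cde)) Be B3e i j)
        - (PsdDyadic.getMZ DSe i j : ℝ) * (1 / 2 ^ ce)| ≤ (ρe : ℝ) * (1 / 2 ^ ce))
    -- ODD sector
    {Bo B3o : ℕ} (hBo : 1 ≤ Bo) (hBBo : 2 * Bo ≤ B3o) {ctabO : List IdxRec}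
    (hCTo : TabColValid S a ks Bo (B3o + 2) ctabO)
    {co cdo d0zo po qo Ksero qr : ℕ} {wso rso : List ℕ} (hd0zo : 0 < d0zo) (hsqo : checkSqrtUpper 8 Bo po qo = true)
    (h0o : 0 < (devOddBox S C F (tget ctabO (Bo + 1)) Bo Bo po qo).lo)
    (hWo : checkWeightsOdd S Ksero C F ctabO Bo (B3o - Bo) cdo wso rso qr po qo = true)
    (hd0o : (d0zo : ℤ) * (S : ℤ) ≤ (devOddBox S C F (tget ctabO (B3o + 1)) B3o Bo po qo).lo * 2 ^ cdo)
    {ρo δo : ℤ} {DSo Lo : List (List ℤ)} (hPo : PsdDyadic.checkPsdMid Bo δo ρo DSo Lo = true)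
    (hnearo : ∀ k k' : Fin Bo,
      |(((gramCoeff a (((k : ℕ) : ℤ) + 1) (((k' : ℕ) : ℤ) + 1) - gramCoeff a (((k : ℕ) : ℤ) + 1) (-(((k' : ℕ) : ℤ) + 1))) / 2)
        - (∑ l ∈ Finset.Ico Bo B3o, ((gramCoeff a (((k : ℕ) : ℤ) + 1) ((l : ℤ) + 1) - gramCoeff a (((k : ℕ) : ℤ) + 1) (-((l : ℤ) + 1))) / 2) *
            ((gramCoeff a (((k' : ℕ) : ℤ) + 1) ((l : ℤ) + 1) - gramCoeff a (((k' : ℕ) : ℤ) + 1) (-((l : ℤ) + 1))) / 2) /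
              (woF wso cdo Bo l))
        - U2Odd a 1 ((d0zo : ℝ) * (1 / 2 ^ cdo)) Bo B3o k k')
        - (PsdDyadic.getMZ DSo k k' : ℝ) * (1 / 2 ^ co)| ≤ (ρo : ℝ) * (1 / 2 ^ co)) :
    WeilPositivityOn a := by
  have hSr : (0 : ℝ) < S := by exact_mod_cast hS
  -- EVEN numeric facts
  have hBe1 : 1 ≤ Be := by omega
  have hreBe : MI.mem S (reDigammaQuarter (freq a Be)) (tget tab Be).reP := (hTe Be (by omega)).2.reP
  have hreB3e : MI.mem S (reDigammaQuarter (freq a B3e)) (tget ctabE B3e).reP := (hCTe B3e (by omega) (by omega)).2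
  have hloBe := devEvenBox_lo_le hS ha hC hF hreBe (by omega) hsqe
  have hloB3e := devEvenBox_lo_le hS ha hC hF hreB3e (by omega) hsqe
  have h0e' : 0 < devEven a Be Be := by
    have : (0 : ℝ) < (devEvenBox S C F (tget tab Be) Be pe qe).lo := by exact_mod_cast h0e
    nlinarith
  have hwe' : (wze : ℝ) * (1 / 2 ^ cde) ≤ devEven a Be Be := dyadic_le_of_lo hS hwe hloBe
  have hd0e' : (d0ze : ℝ) * (1 / 2 ^ cde) ≤ devEven a Be B3e := dyadic_le_of_lo hS hd0e hloB3e
  have hwpos : (0 : ℝ) < (wze : ℝ) * (1 / 2 ^ cde) := by positivity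
  have hd0pos : (0 : ℝ) < (d0ze : ℝ) * (1 / 2 ^ cde) := by positivity
  -- ODD numeric facts
  have hreBo : MI.mem S (reDigammaQuarter (freq a ((Bo : ℤ) + 1))) (tget ctabO (Bo + 1)).reP := by
    have h := (hCTo (Bo + 1) (by omega) (by omega)).2
    push_cast at h; exact h
  have hreB3o : MI.mem S (reDigammaQuarter (freq a ((B3o : ℤ) + 1))) (tget ctabO (B3o + 1)).reP := by
    have h := (hCTo (B3o + 1) (by omega) (by omega)).2
    push_cast at h; exact h
  have hloBo := devOddBox_lo_le hS ha hC hF hreBo (by omega) hsqo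
  have hloB3o := devOddBox_lo_le hS ha hC hF hreB3o (by omega) hsqo
  have h0o' : 0 < devOdd0 a Bo Bo := by
    have : (0 : ℝ) < (devOddBox S C F (tget ctabO (Bo + 1)) Bo Bo po qo).lo := by exact_mod_cast h0o
    nlinarith
  have hd0o' : (d0zo : ℝ) * (1 / 2 ^ cdo) ≤ devOdd0 a Bo B3o := dyadic_le_of_lo hS hd0o hloB3o
  have hd0opos : (0 : ℝ) < (d0zo : ℝ) * (1 / 2 ^ cdo) := by positivity
  have hWts := weights_of_checkOdd hS ha hC hF (by omega) hsqo hCTo (by omega) hWo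
  refine weilPositivityOn_of_formatC_data ha hBe hBBe (θe := 1) (d0e := (d0ze : ℝ) * (1 / 2 ^ cde)) one_pos
    (fun _ ↦ (wze : ℝ) * (1 / 2 ^ cde)) ?_ ?_ ?_ ?_ hBo hBBo (θo := 1) (d0o := (d0zo : ℝ) * (1 / 2 ^ cdo)) one_pos
    (woF wso cdo Bo) ?_ ?_ ?_ ?_
  · -- h0e
    have h := h0e'; unfold devEven at h; exact h
  · -- hd0e
    refine ⟨hd0pos, ?_⟩
    have h := hd0e'; unfold devEven at h; exact h
  · -- hwe
    intro m hm _
    refine ⟨hwpos, ?_⟩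
    have h := hwe'.trans (devEven_mono ha hBe1 hm)
    unfold devEven at h; exact h
  · -- hSe
    intro x
    refine PsdDyadic.psd_of_checkPsdMid hPe (u := 1 / 2 ^ ce) (by positivity) _ (fun i j ↦ ?_) x
    have h := hneare i j
    rw [← U2Even_fin] at h
    exact h
  · -- h0o
    have h := h0o'; unfold devOdd0 at h; exact h
  · -- hd0o
    refine ⟨hd0opos, ?_⟩
    have h := hd0o'; unfold devOdd0 at h; exact h
  · -- hwo (per column)
    intro l hl hlB
    have h := hWts l hl (by omega)
    unfold devOddA at h
    exact h
  · -- hSo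
    intro x
    refine PsdDyadic.psd_of_checkPsdMid hPo (u := 1 / 2 ^ co) (by positivity) _ (fun k k' ↦ ?_) x
    have h := hnearo k k'
    rw [← U2Odd_fin] at h
    exact h

end Summit.RiemannHypothesis.RiemannHypothesis.Theorems.WeilFormatC

end
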